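import Summits.CriticalPhenomena.SAWScalingLimit.Theorems.SAWLeftRightFKGFKGToTraversalBoundGatesDefs
import Summits.CriticalPhenomena.SAWScalingLimit.Theorems.FKGToTraversalBound.Negative.DeepStartNotPresentable
import Summits.CriticalPhenomena.SAWScalingLimit.Theorems.SAWRenewalTightnessShellCrossingBoundTravCount
import HarnessLib

/-!
# Germ excursion mean: the boundary-approximation case is free (helper `germExcursionMean_of_bdry`)

Crux `SAWLeftRightFKG.FKGToTraversalBound` (stmt-CriticalPhenomena-1878), line `gates-by-bubble-doors-by-fkg`,
registered stub `stub_germExcursionMean : GermExcursionMean` (the rate-free first-moment input of the deep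
fragment, `Theorems/SAWLeftRightFKGFKGToTraversalBoundGatesDefs.lean`).  `GermExcursionMean` asks, for every
endpoint approximation, for `M̄, C₀ > 11/10, δ₀ > 0` with
`E_δ[N_δ] = Σ_{k ≥ 0} P_δ(HasTraversals (k+1) …) ≤ M̄` for `δ ≤ δ₀`, where `N_δ` is the number of separate
traversals by the chord's mesh polyline of the crossover annulus `D(δ·a_δ; 1.1 d, C₀ d)`,
`d = d(δ) = infDist (δ·a_δ) Dᶜ` (and the same at `b`).

This file proves the statement ON THE BOUNDARY-APPROXIMATION CLASS `d(δ) ≤ K δ` (registered helper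
`germExcursionMean_of_bdry`), where it is deterministic: with `C₀ = 2` the inner radius is `1.1 d ≤ 1.1 K δ`,
and the tree's quantitative Aizenman–Burchard short-distance cutoff
`Theorems.not_hasTraversals_domainSAW_of_le_mesh` (a self-avoiding lattice polyline of mesh `δ` never makes
`N(n) = 2((2n+1)⁴ + 1) + 1` separate traversals of a shell of inner radius `ρ`, `n = ⌈ρ/δ⌉₊ + 2`) is made
scale-free (`not_hasTraversals_of_radius_le_mul_mesh`: `ρ ≤ L δ ⇒` no `N(⌈L⌉₊ + 2)` traversals), so the
events `HasTraversals (k+1)` are EMPTY for `k + 1 ≥ N` and the mean is a finite sum of `≤ N` probabilities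
(`tsum_law_hasTraversals_succ_le`), `M̄ := N(⌈1.1 K⌉₊ + 2)`.  The only use of `IsEndpointApprox` is to make
`d(δ) > 0` for small `δ` (both legs are eventually sites of `Ω_δ ⊆ D`, `eventually_start_mem_meshDomain` and
its mirror `eventually_snd_mem_meshDomain`), which keeps the annulus genuine (`1.1 d < 2 d`); `δ₀` is chosen
inside that germ and below `δ₁`.

Consequently the content of `GermExcursionMean` lies exactly on the deep fragment `d(δ)/δ → ∞` (lead's audit,
`work/stubs/germ_audit.md`).  Only theorems; no named fact; no new definition.
-/

noncomputable section

open MeasureTheory Filter Topology Set Metric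
open scoped NNReal ENNReal
open Literature.Probability.LatticeModels
open Literature.Probability.RandomPlanarGeometry
open Literature.Probability.RandomPlanarGeometry.SAW
open Summit.CriticalPhenomena.SAWScalingLimit.Theorems.FKGToTraversalBound.Negative
  (eventually_start_mem_meshDomain)

namespace Summit.CriticalPhenomena.SAWScalingLimit.Theorems.FKGToTraversalBound.GatesByBubbleDoorsByFKG

/-! ### Probabilities are at most one; legs of an approximation are eventually sites of `Ω_δ` -/

/-- Whatever the junk conventions (`law = 0` without chords), the SAW law gives mass `≤ 1` to every event:
`law S ≤ (Z)⁻¹ · Z ≤ 1`. [folklore] -/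
private theorem law_apply_le_one_aux (Ω : Set ℂ) (δ : ℝ) (u v : Site 2) (S : Set (DomainSAW Ω δ u v)) :
    law Ω δ u v S ≤ 1 := by
  calc law Ω δ u v S ≤ law Ω δ u v Set.univ := measure_mono (Set.subset_univ _)
    _ = (weight Ω δ u v Set.univ)⁻¹ * weight Ω δ u v Set.univ := by
        rw [law, Measure.smul_apply, smul_eq_mul]
    _ ≤ 1 := ENNReal.inv_mul_le_one _

/-- Mirror of `Negative.eventually_start_mem_meshDomain`: along an endpoint approximation the END `b δ` is
eventually a site of `Ω_δ` (the legs tend to the two distinct marked points, so they are eventually distinct,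
and the reversed joining walk of positive length starts with an edge of `Ω_δ`). [folklore] -/
theorem eventually_snd_mem_meshDomain {D : DobrushinDomain} {a b : ℝ → Site 2}
    (hab : IsEndpointApprox D a b) : ∀ᶠ δ in 𝓝[>] (0 : ℝ), b δ ∈ meshDomain D.carrier δ := by
  have hpq : D.pt 0 ≠ D.pt 1 := fun h => absurd (D.pt_injective h) (by decide)
  have hr : 0 < dist (D.pt 0) (D.pt 1) / 2 := by
    have := dist_pos.2 hpq
    positivity
  filter_upwards [(Metric.tendsto_nhds.1 hab.tendsto_fst) _ hr,
    (Metric.tendsto_nhds.1 hab.tendsto_snd) _ hr, hab.reachable] with δ hδa hδb hreach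
  have hne : b δ ≠ a δ := by
    intro heq
    rw [heq] at hδb
    have h3 := dist_triangle (D.pt 0) (meshPoint δ (a δ)) (D.pt 1)
    rw [dist_comm] at hδa
    linarith
  have key : ∀ (x y : Site 2) (q : (discreteDomainGraph D.carrier δ).Walk x y), x ≠ y →
      x ∈ meshDomain D.carrier δ := by
    intro x y q hxy
    cases q with
    | nil => exact absurd rfl hxy
    | cons hadj _ => exact (discreteDomainGraph_adj_iff.1 hadj).2.1
  obtain ⟨p⟩ := hreach
  exact key _ _ p.reverse hne

/-- A site of `Ω_δ` has positive depth: its mesh point lies in the open carrier, whose complement is closed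
and nonempty (the carrier is bounded). [folklore] -/
theorem infDist_compl_pos_of_mem_meshDomain {D : DobrushinDomain} {δ : ℝ} {x : Site 2}
    (hx : x ∈ meshDomain D.carrier δ) : 0 < infDist (meshPoint δ x) D.carrierᶜ :=
  (D.isOpen.isClosed_compl.notMem_iff_infDist_pos (Set.nonempty_compl.2 D.carrier_ne_univ)).1
    fun h => h (meshDomain_subset_meshVertices _ _ hx)

/-! ### The scale-free short-distance cutoff and the finite mean -/

/-- **Scale-free short-distance cutoff.** At mesh `δ > 0`, a self-avoiding polyline of `Ω_δ` never makes
`2((2n+1)²(2n+1)² + 1) + 1` separate traversals of a shell `D(x; ρ, R)` whose inner radius satisfies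
`0 < ρ ≤ L δ`, `ρ < R`, with `n = ⌈L⌉₊ + 2` INDEPENDENT OF `δ` (the tree's
`not_hasTraversals_domainSAW_of_le_mesh` at mesh floor `δ₁ = δ`, `⌈ρ/δ⌉₊ ≤ ⌈L⌉₊`, and monotonicity of
`HasTraversals` in the count).  (Aizenman–Burchard 1999, §1.a.) [folklore] -/
theorem not_hasTraversals_of_radius_le_mul_mesh {Ω : Set ℂ} {δ ρ R L : ℝ} {u v : Site 2}
    (hδ : 0 < δ) (hρ : 0 < ρ) (hρL : ρ ≤ L * δ) (hρR : ρ < R) (γ : DomainSAW Ω δ u v) (x : ℂ) :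
    ¬ (⟨γ.walk.toCurve (meshPoint δ)⟩ : Curve ℂ).HasTraversals
      (2 * ((2 * (⌈L⌉₊ + 2) + 1) ^ 2 * (2 * (⌈L⌉₊ + 2) + 1) ^ 2 + 1) + 1) x ρ R := by
  intro h
  have hceil : ⌈ρ / δ⌉₊ ≤ ⌈L⌉₊ := Nat.ceil_mono ((div_le_iff₀ hδ).2 hρL)
  have hmono : 2 * ((2 * (⌈ρ / δ⌉₊ + 2) + 1) ^ 2 * (2 * (⌈ρ / δ⌉₊ + 2) + 1) ^ 2 + 1) + 1 ≤
      2 * ((2 * (⌈L⌉₊ + 2) + 1) ^ 2 * (2 * (⌈L⌉₊ + 2) + 1) ^ 2 + 1) + 1 := by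
    gcongr
  exact not_hasTraversals_domainSAW_of_le_mesh hρ hδ γ le_rfl hρR (h.of_le hmono)

/-- **Finite mean below the cutoff.** Under the same hypotheses the expected number of separate traversals,
`Σ_{k ≥ 0} P(HasTraversals (k+1))`, is at most the cutoff count `N = 2((2n+1)²(2n+1)² + 1) + 1`,
`n = ⌈L⌉₊ + 2`: the events are empty for `k + 1 > N`… indeed already for `k ≥ N`, and each of the `N`
remaining probabilities is `≤ 1` (`tsum_eq_sum`). [folklore] -/
theorem tsum_law_hasTraversals_succ_le {Ω : Set ℂ} {δ ρ R L : ℝ} {u v : Site 2}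
    (hδ : 0 < δ) (hρ : 0 < ρ) (hρL : ρ ≤ L * δ) (hρR : ρ < R) (x : ℂ) :
    (∑' k : ℕ, law Ω δ u v
        {γ | (⟨γ.walk.toCurve (meshPoint δ)⟩ : Curve ℂ).HasTraversals (k + 1) x ρ R}) ≤
      ((2 * ((2 * (⌈L⌉₊ + 2) + 1) ^ 2 * (2 * (⌈L⌉₊ + 2) + 1) ^ 2 + 1) + 1 : ℕ) : ℝ≥0∞) := by
  classical
  set N : ℕ := 2 * ((2 * (⌈L⌉₊ + 2) + 1) ^ 2 * (2 * (⌈L⌉₊ + 2) + 1) ^ 2 + 1) + 1 with hN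
  have hzero : ∀ k ∉ Finset.range N, law Ω δ u v
      {γ | (⟨γ.walk.toCurve (meshPoint δ)⟩ : Curve ℂ).HasTraversals (k + 1) x ρ R} = 0 := by
    intro k hk
    rw [Finset.mem_range, not_lt] at hk
    have hempty : {γ : DomainSAW Ω δ u v |
        (⟨γ.walk.toCurve (meshPoint δ)⟩ : Curve ℂ).HasTraversals (k + 1) x ρ R} = ∅ := by
      ext γ
      simp only [mem_setOf_eq, mem_empty_iff_false, iff_false]
      intro hγ
      exact not_hasTraversals_of_radius_le_mul_mesh hδ hρ hρL hρR γ x (hγ.of_le (by omega))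
    rw [hempty, measure_empty]
  rw [tsum_eq_sum (s := Finset.range N) hzero]
  calc ∑ k ∈ Finset.range N, law Ω δ u v
          {γ | (⟨γ.walk.toCurve (meshPoint δ)⟩ : Curve ℂ).HasTraversals (k + 1) x ρ R}
      ≤ ∑ _k ∈ Finset.range N, (1 : ℝ≥0∞) :=
        Finset.sum_le_sum fun k _ => law_apply_le_one_aux Ω δ u v _
    _ = N := by simp

/-! ### The registered helper -/

/-- **`GermExcursionMean` on the boundary-approximation class** (registered helper `germExcursionMean_of_bdry`
of stmt-CriticalPhenomena-1878).  If along the approximation both depths are `O(δ)`,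
`infDist (δ·a_δ) Dᶜ ≤ K δ` and `infDist (δ·b_δ) Dᶜ ≤ K δ` for `0 < δ ≤ δ₁`, then the conclusion of
`GermExcursionMean` holds with `C₀ = 2`, `M̄ = 2((2n+1)²(2n+1)² + 1) + 1`, `n = ⌈(11/10) K⌉₊ + 2`, and `δ₀`
below `δ₁` and inside the germ where both legs are sites of `Ω_δ` (so that the depths are positive and the
annulus `D(·; 1.1 d, 2 d)` is genuine): there the traversal events are empty beyond the scale-free cutoff and the
mean is a finite sum of probabilities (`tsum_law_hasTraversals_succ_le`).  Hence `GermExcursionMean` has content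
only on the deep fragment `d(δ)/δ → ∞`. [folklore] -/
theorem germExcursionMean_of_bdry : ∀ (D : DobrushinDomain) (a b : ℝ → Site 2), IsEndpointApprox D a b →
    (∃ K δ₁ : ℝ, 0 < δ₁ ∧ ∀ δ ∈ Set.Ioc (0 : ℝ) δ₁, infDist (meshPoint δ (a δ)) D.carrierᶜ ≤ K * δ ∧
      infDist (meshPoint δ (b δ)) D.carrierᶜ ≤ K * δ) →
    ∃ (Mbar C₀ δ₀ : ℝ), 11 / 10 < C₀ ∧ 0 < δ₀ ∧ ∀ δ ∈ Set.Ioc (0 : ℝ) δ₀,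
      (∑' k : ℕ, law D.carrier δ (a δ) (b δ)
          {γ | (⟨γ.walk.toCurve (meshPoint δ)⟩ : Curve ℂ).HasTraversals (k + 1) (meshPoint δ (a δ))
            (11 / 10 * infDist (meshPoint δ (a δ)) D.carrierᶜ) (C₀ * infDist (meshPoint δ (a δ)) D.carrierᶜ)})
        ≤ ENNReal.ofReal Mbar ∧
      (∑' k : ℕ, law D.carrier δ (a δ) (b δ)
          {γ | (⟨γ.walk.toCurve (meshPoint δ)⟩ : Curve ℂ).HasTraversals (k + 1) (meshPoint δ (b δ))
            (11 / 10 * infDist (meshPoint δ (b δ)) D.carrierᶜ) (C₀ * infDist (meshPoint δ (b δ)) D.carrierᶜ)})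
        ≤ ENNReal.ofReal Mbar := by
  intro D a b hab hK
  obtain ⟨K, δ₁, hδ₁, hK⟩ := hK
  obtain ⟨δ₂, hδ₂, hsub⟩ := mem_nhdsGT_iff_exists_Ioo_subset.1
    ((eventually_start_mem_meshDomain hab).and (eventually_snd_mem_meshDomain hab))
  have hδ₂pos : 0 < δ₂ := hδ₂
  set L : ℝ := 11 / 10 * K with hL
  set N : ℕ := 2 * ((2 * (⌈L⌉₊ + 2) + 1) ^ 2 * (2 * (⌈L⌉₊ + 2) + 1) ^ 2 + 1) + 1 with hN
  refine ⟨(N : ℝ), 2, min δ₁ (δ₂ / 2), by norm_num, lt_min hδ₁ (by positivity), fun δ hδ => ?_⟩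
  have hδpos : 0 < δ := hδ.1
  have hδ₁' : δ ∈ Set.Ioc (0 : ℝ) δ₁ := ⟨hδ.1, hδ.2.trans (min_le_left _ _)⟩
  have hδIoo : δ ∈ Set.Ioo (0 : ℝ) δ₂ :=
    ⟨hδ.1, lt_of_le_of_lt (hδ.2.trans (min_le_right _ _)) (by linarith)⟩
  obtain ⟨haM, hbM⟩ := hsub hδIoo
  obtain ⟨hKa, hKb⟩ := hK δ hδ₁'
  have hda := infDist_compl_pos_of_mem_meshDomain haM
  have hdb := infDist_compl_pos_of_mem_meshDomain hbM
  rw [ENNReal.ofReal_natCast]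
  refine ⟨tsum_law_hasTraversals_succ_le hδpos (by positivity) ?_ (by linarith) _,
    tsum_law_hasTraversals_succ_le hδpos (by positivity) ?_ (by linarith) _⟩
  · calc 11 / 10 * infDist (meshPoint δ (a δ)) D.carrierᶜ ≤ 11 / 10 * (K * δ) :=
          mul_le_mul_of_nonneg_left hKa (by norm_num)
      _ = L * δ := by rw [hL]; ring
  · calc 11 / 10 * infDist (meshPoint δ (b δ)) D.carrierᶜ ≤ 11 / 10 * (K * δ) :=
          mul_le_mul_of_nonneg_left hKb (by norm_num)
      _ = L * δ := by rw [hL]; ring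

end Summit.CriticalPhenomena.SAWScalingLimit.Theorems.FKGToTraversalBound.GatesByBubbleDoorsByFKG

end
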